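import Literature.NumberTheory.LFunctions.WeightedDiscreteMeanValueSeries
import Mathlib.Analysis.SpecialFunctions.Integrals.Basic
import HarnessLib

/-!
# Proposition 5.4 (Conrey–Iwaniec 2002) with point-dependent weights, ONE-SIDED at a floor

B. Conrey, H. Iwaniec, *Spacing of zeros of Hecke L-functions and the class number problem*,
Acta Arith. 103 (2002), §5 [held text `paper:arxiv-math_0111012`, p0013–p0014]: Proposition 5.4
(5.19) passes from the discrete mean value `Σ_r |Σ_n a_n n^{−ρ_r} f_r(n)|²` over `δ`-spaced points
`T ≤ γ_r ≤ 2T` to the integral `∫ K(t/T)|A(it)|² dt` with `K ≥ 1` on `[½, 3]`, i.e. to the window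
`[T/2, 3T]` (tree: `WeightedMeanValue.weighted_discreteMeanValue_integral`). When the integral is to be
evaluated by Proposition 6.4, which exists only from a FLOOR `F` upwards (`T′ ≥ q^{65}`), the part
`[T/2, F)` of that window is not available for `F > T/2`.

THIS FILE proves the one-sided variant: if all points lie ABOVE `F + D` (`D ≥ 1`), the Poisson
density `G(τ) = Σ_t (1 + (τ − t)²)^{−1}` of the points is `≤ 4/(δD)` for `τ < F` (the arctangent
tail `∫_A^B (1+(τ−u)²)^{−1}du ≤ 1/(A − τ)`), so the main integral is needed only on
`[max(T/2, F), 3T]`, at the price of the factor `T/D + 1` on the trivial (Montgomery–Vaughan) term: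

* `sum_inv_one_add_sq_le_floor` — the density bound
  `G(τ) ≤ (2π/δ)𝟙_{[max(T/2,F), 3T]}(τ) + (4/(δD))𝟙_{[T/2, 3T]}(τ) + (120/(δT))(1 + τ²/T²)^{−1}`;
* `weighted_discreteMeanValue_integral_floor` — for `δ`-separated `𝒯 ⊂ [T, 2T] ∩ [F + D, ∞)`,
  `Σ_t |Σ_{n≤N} a_n ω_t(log n) n^{−it}|² ≤ 180·c·δ⁻¹·(∫_{max(T/2,F)}^{3T}|Σ a_n n^{−iτ}|²dτ + (T/D + 1)Σ(1+n/T)|a_n|²)`;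
* `weighted_discreteMeanValue_integral_floor_tsum` — the same for absolutely convergent series.

These feed the Conrey–Iwaniec §8 mean squares at levels `T ∈ [q^{65}, 2q^{65})` (cell landau-siegel /
ls-inputs, I6b: the binder range `q^{65} ≤ T` of Proposition 9.1). Everything PROVED; no definition.

«The programme SEARCHES and TYPES; no claim about Landau–Siegel zeros until a kernel theorem says so.»

## References
* [ConreyIwaniec2002] B. Conrey, H. Iwaniec, Acta Arith. 103 (2002) 259–312, arXiv:math/0111012:
  §5 (5.10)–(5.16), Lemma 5.3 (5.17), Proposition 5.4 (5.18)–(5.19); §8 p. 18 ("we assume that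
  `T ≥ q^{65}` to comply with the condition of Proposition 6.4").
-/

noncomputable section

open Complex MeasureTheory Filter Set Finset Real
open scoped Topology Real

namespace Literature.NumberTheory.LFunctions

namespace WeightedMeanValue

open Gallagher (phase norm_phase continuous_phase natCast_cpow_eq_phase)

/-! ## §1. The arctangent tail of the Poisson kernel -/

/-- `arctan v ≤ v` for `v ≥ 0`. [folklore] -/
private theorem arctan_le_self' {v : ℝ} (hv : 0 ≤ v) : Real.arctan v ≤ v := by
  rcases hv.eq_or_lt with h | h
  · rw [← h, Real.arctan_zero]
  · have h1 : 0 < Real.arctan v := by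
      rw [← Real.arctan_zero]; exact Real.arctan_strictMono h
    have h2 : Real.arctan v < π / 2 := Real.arctan_lt_pi_div_two v
    have := Real.le_tan h1.le h2
    rwa [Real.tan_arctan] at this

/-- **The one-sided tail of the Poisson kernel**: if `τ + d ≤ A ≤ B` with `d > 0` then
`∫_A^B (1 + (τ − u)²)^{−1} du ≤ 1/d` (`= arctan(B − τ) − arctan(A − τ) ≤ π/2 − arctan d = arctan(1/d) ≤ 1/d`).
[cite: ConreyIwaniec2002, §5 (display before (5.12))] -/
theorem intervalIntegral_inv_one_add_sq_le_inv {τ A B d : ℝ} (hd : 0 < d) (hA : τ + d ≤ A) :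
    ∫ u in A..B, (1 + (τ - u) ^ 2)⁻¹ ≤ 1 / d := by
  have h1 : ∫ u in A..B, (1 + (τ - u) ^ 2)⁻¹ = ∫ u in A..B, (fun v : ℝ => (1 + v ^ 2)⁻¹) (u - τ) := by
    refine intervalIntegral.integral_congr fun u _ => ?_
    simp only
    rw [show (τ - u) ^ 2 = (u - τ) ^ 2 by ring]
  rw [h1, intervalIntegral.integral_comp_sub_right (fun v : ℝ => (1 + v ^ 2)⁻¹) τ]
  have h2 : ∫ v in (A - τ)..(B - τ), (1 + v ^ 2)⁻¹ = Real.arctan (B - τ) - Real.arctan (A - τ) := by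
    simp
  rw [h2]
  have h3 : Real.arctan (B - τ) < π / 2 := Real.arctan_lt_pi_div_two _
  have hApos : 0 < A - τ := by linarith
  have h4 : π / 2 - Real.arctan (A - τ) = Real.arctan (A - τ)⁻¹ :=
    (Real.arctan_inv_of_pos hApos).symm
  have h5 : Real.arctan (A - τ)⁻¹ ≤ (A - τ)⁻¹ := arctan_le_self' (by positivity)
  have h6 : (A - τ)⁻¹ ≤ 1 / d := by
    rw [one_div]; exact inv_anti₀ hd (by linarith)
  linarith

/-! ## §2. The Poisson-weight density of points above a floor -/

/-- **The Poisson-weight density for points in `[T, 2T]` lying above `F + D`**: for `δ`-separated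
`𝒯 ⊂ [T, 2T]` (`0 < δ ≤ 1`, `T ≥ 2`) with `t ≥ F + D` for all `t ∈ 𝒯` (`D ≥ 1`, `F ≤ T`), and all `τ`,
`Σ_{t∈𝒯}(1+(τ−t)²)^{−1} ≤ (2π/δ)·𝟙_{[max(T/2,F), 3T]}(τ) + (4/(δD))·𝟙_{[T/2,3T]}(τ) + (120/(δT))(1+τ²/T²)^{−1}`:
below the floor the window `[F + D − δ/2, 2T + δ/2]` is at distance `≥ D/2`.
[cite: ConreyIwaniec2002, §5 (5.12)] -/
theorem sum_inv_one_add_sq_le_floor {δ T F D : ℝ} (hδ : 0 < δ) (hδ1 : δ ≤ 1) (hT : 2 ≤ T)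
    (hD : 1 ≤ D) (𝒯 : Finset ℝ) (hmem : ∀ t ∈ 𝒯, T ≤ t ∧ t ≤ 2 * T)
    (hfl : ∀ t ∈ 𝒯, F + D ≤ t)
    (hsep : ∀ t ∈ 𝒯, ∀ t' ∈ 𝒯, t ≠ t' → δ ≤ |t - t'|) (τ : ℝ) :
    ∑ t ∈ 𝒯, (1 + (τ - t) ^ 2)⁻¹ ≤
      (2 * π / δ) * Set.indicator (Set.Icc (max (T / 2) F) (3 * T)) (fun _ => (1 : ℝ)) τ +
        (4 / (δ * D)) * Set.indicator (Set.Icc (T / 2) (3 * T)) (fun _ => (1 : ℝ)) τ +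
        (120 / (δ * T)) * (1 + τ ^ 2 / T ^ 2)⁻¹ := by
  have hT0 : 0 < T := by linarith
  have hD0 : 0 < D := by linarith
  have hdy := sum_inv_one_add_sq_le_dyadic hδ hδ1 hT 𝒯 hmem hsep τ
  have hfirst0 : 0 ≤ (2 * π / δ) * Set.indicator (Set.Icc (max (T / 2) F) (3 * T)) (fun _ => (1 : ℝ)) τ := by
    apply mul_nonneg (by positivity)
    exact Set.indicator_nonneg (fun _ _ => zero_le_one) _
  have hsecond0 : 0 ≤ (4 / (δ * D)) * Set.indicator (Set.Icc (T / 2) (3 * T)) (fun _ => (1 : ℝ)) τ := by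
    apply mul_nonneg (by positivity)
    exact Set.indicator_nonneg (fun _ _ => zero_le_one) _
  have hthird0 : 0 ≤ (120 / (δ * T)) * (1 + τ ^ 2 / T ^ 2)⁻¹ := by positivity
  have h4pos : 0 ≤ 4 / (δ * D) := by positivity
  by_cases hτ : τ ∈ Set.Icc (T / 2) (3 * T)
  · -- inside the classical window
    rw [Set.indicator_of_mem hτ, mul_one]
    by_cases hτF : F ≤ τ
    · -- above the floor: the classical bound `2π/δ`
      have hmem' : τ ∈ Set.Icc (max (T / 2) F) (3 * T) := ⟨max_le hτ.1 hτF, hτ.2⟩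
      rw [Set.indicator_of_mem hmem', mul_one]
      rw [Set.indicator_of_mem hτ, mul_one] at hdy
      linarith
    · -- below the floor: the points are at distance `≥ D/2` beyond `τ`
      push Not at hτF
      rcases 𝒯.eq_empty_or_nonempty with h0 | hne
      · rw [h0, Finset.sum_empty]; linarith
      · obtain ⟨t₀, ht₀⟩ := hne
        have hX : F + D ≤ 2 * T := (hfl t₀ ht₀).trans (hmem t₀ ht₀).2
        have h1 := sum_inv_one_add_sq_le hδ hδ1 𝒯 (X₁ := F + D) (X₂ := 2 * T) hX
          (fun t ht => ⟨hfl t ht, (hmem t ht).2⟩) hsep τ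
        have h2 : ∫ u in (F + D - δ / 2)..(2 * T + δ / 2), (1 + (τ - u) ^ 2)⁻¹ ≤ 1 / (D / 2) :=
          intervalIntegral_inv_one_add_sq_le_inv (by positivity) (by linarith)
        have h3 : ∑ t ∈ 𝒯, (1 + (τ - t) ^ 2)⁻¹ ≤ 4 / (δ * D) := by
          calc ∑ t ∈ 𝒯, (1 + (τ - t) ^ 2)⁻¹
              ≤ (2 / δ) * ∫ u in (F + D - δ / 2)..(2 * T + δ / 2), (1 + (τ - u) ^ 2)⁻¹ := h1
            _ ≤ (2 / δ) * (1 / (D / 2)) := mul_le_mul_of_nonneg_left h2 (by positivity)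
            _ = 4 / (δ * D) := by field_simp; ring
        linarith
  · -- outside the classical window: the far bound of the dyadic lemma
    rw [Set.indicator_of_notMem hτ, mul_zero] at hdy
    have hτ' : τ ∉ Set.Icc (max (T / 2) F) (3 * T) := by
      intro h
      exact hτ ⟨le_trans (le_max_left _ _) h.1, h.2⟩
    rw [Set.indicator_of_notMem hτ, Set.indicator_of_notMem hτ', mul_zero, mul_zero]
    linarith

/-! ## §3. Proposition 5.4 one-sided at a floor -/

/-- **Proposition 5.4 (Conrey–Iwaniec) with point-dependent weights, ONE-SIDED at a floor.**
Let `𝒯 ⊂ [T, 2T]` (`T ≥ 2`) be `δ`-separated (`0 < δ ≤ 1`) with every point `≥ F + D` (`D ≥ 1`,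
`F ≤ T`), and the weights `ω_t` as in Lemma 5.3 with `‖ω_t‖₂² + ‖ω_t′‖₂² ≤ c`. Then
`Σ_t |Σ_{n≤N} a_n ω_t(log n) n^{−it}|² ≤ 180·c·δ⁻¹·(∫_{max(T/2,F)}^{3T} |Σ a_n n^{−iτ}|² dτ + (T/D + 1)·Σ (1 + n/T)|a_n|²)`
— the integral is needed only ABOVE the floor. [cite: ConreyIwaniec2002, Proposition 5.4 (5.19)] -/
theorem weighted_discreteMeanValue_integral_floor (N : ℕ) (a : ℕ → ℂ) {T δ c F D : ℝ} (𝒯 : Finset ℝ)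
    (ω : ℝ → ℝ → ℂ) (hT : 2 ≤ T) (hδ : 0 < δ) (hδ1 : δ ≤ 1) (hc : 0 ≤ c) (hD : 1 ≤ D) (hF : F ≤ T)
    (hmem : ∀ t ∈ 𝒯, T ≤ t ∧ t ≤ 2 * T) (hfl : ∀ t ∈ 𝒯, F + D ≤ t)
    (hsep : ∀ t ∈ 𝒯, ∀ t' ∈ 𝒯, t ≠ t' → δ ≤ |t - t'|)
    (hω : ∀ t ∈ 𝒯, Differentiable ℝ (ω t) ∧ Integrable (ω t) ∧ Integrable (deriv (ω t)) ∧
      MemLp (ω t) 2 ∧ MemLp (deriv (ω t)) 2 ∧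
      (∫ y : ℝ, ‖ω t y‖ ^ 2) + (∫ y : ℝ, ‖deriv (ω t) y‖ ^ 2) ≤ c) :
    ∑ t ∈ 𝒯, ‖∑ n ∈ Finset.Icc 1 N, a n * ω t (Real.log n) * (n : ℂ) ^ (-((t : ℂ) * I))‖ ^ 2 ≤
      180 * c * δ⁻¹ *
        ((∫ τ in (max (T / 2) F)..(3 * T), ‖∑ n ∈ Finset.Icc 1 N, a n * (n : ℂ) ^ (-((τ : ℂ) * I))‖ ^ 2) +
          (T / D + 1) * ∑ n ∈ Finset.Icc 1 N, (1 + n / T) * ‖a n‖ ^ 2) := by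
  have hT0 : 0 < T := by linarith
  have hD0 : 0 < D := by linarith
  have h1 := sum_norm_sq_weightedSum_le N a 𝒯 ω hω
  refine h1.trans ?_
  set Dp : ℝ → ℂ := fun τ => ∑ n ∈ Finset.Icc 1 N, a n * (n : ℂ) ^ (-((τ : ℂ) * I)) with hDp
  set W : Set ℝ := Set.Icc (max (T / 2) F) (3 * T) with hW
  set W₀ : Set ℝ := Set.Icc (T / 2) (3 * T) with hW₀
  set M : ℝ → ℝ := fun τ => (2 * π / δ) * Set.indicator W (fun _ => (1 : ℝ)) τ +
    (4 / (δ * D)) * Set.indicator W₀ (fun _ => (1 : ℝ)) τ +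
    (120 / (δ * T)) * (1 + τ ^ 2 / T ^ 2)⁻¹ with hM
  have hG : ∀ τ, ∑ t ∈ 𝒯, (1 + (τ - t) ^ 2)⁻¹ ≤ M τ :=
    fun τ => sum_inv_one_add_sq_le_floor hδ hδ1 hT hD 𝒯 hmem hfl hsep τ
  have hint1 : Integrable fun τ : ℝ => ‖Dp τ‖ ^ 2 * ∑ t ∈ 𝒯, (1 + (τ - t) ^ 2)⁻¹ := by
    have : (fun τ : ℝ => ‖Dp τ‖ ^ 2 * ∑ t ∈ 𝒯, (1 + (τ - t) ^ 2)⁻¹) =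
        fun τ => ∑ t ∈ 𝒯, ‖Dp τ‖ ^ 2 * (1 + (τ - t) ^ 2)⁻¹ := by
      funext τ; rw [Finset.mul_sum]
    rw [this]
    exact integrable_finsetSum _ fun t _ =>
      sum_norm_sq_weightedSum_le.integrable_norm_sq_dpoly_mul_inv a N t
  -- indicator pieces as restricted integrands
  have hind : ∀ (E : Set ℝ) (τ : ℝ), ‖Dp τ‖ ^ 2 * Set.indicator E (fun _ => (1 : ℝ)) τ =
      Set.indicator E (fun τ => ‖Dp τ‖ ^ 2) τ := by
    intro E τ
    by_cases h : τ ∈ E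
    · rw [Set.indicator_of_mem h, Set.indicator_of_mem h, mul_one]
    · rw [Set.indicator_of_notMem h, Set.indicator_of_notMem h, mul_zero]
  have hpieceW : Integrable fun τ : ℝ => ‖Dp τ‖ ^ 2 * Set.indicator W (fun _ => (1 : ℝ)) τ := by
    have : (fun τ : ℝ => ‖Dp τ‖ ^ 2 * Set.indicator W (fun _ => (1 : ℝ)) τ) =
        Set.indicator W (fun τ => ‖Dp τ‖ ^ 2) := funext (hind W)
    rw [this, hW, integrable_indicator_iff measurableSet_Icc]
    exact ((continuous_dpoly a N).norm.pow 2).continuousOn.integrableOn_compact isCompact_Icc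
  have hpieceW₀ : Integrable fun τ : ℝ => ‖Dp τ‖ ^ 2 * Set.indicator W₀ (fun _ => (1 : ℝ)) τ := by
    have : (fun τ : ℝ => ‖Dp τ‖ ^ 2 * Set.indicator W₀ (fun _ => (1 : ℝ)) τ) =
        Set.indicator W₀ (fun τ => ‖Dp τ‖ ^ 2) := funext (hind W₀)
    rw [this, hW₀, integrable_indicator_iff measurableSet_Icc]
    exact ((continuous_dpoly a N).norm.pow 2).continuousOn.integrableOn_compact isCompact_Icc
  have hpieceB := integrable_norm_sq_dpoly_mul_cauchy a N hT0
  have hintM : Integrable fun τ : ℝ => ‖Dp τ‖ ^ 2 * M τ := by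
    have : (fun τ : ℝ => ‖Dp τ‖ ^ 2 * M τ) = fun τ =>
        (2 * π / δ) * (‖Dp τ‖ ^ 2 * Set.indicator W (fun _ => (1 : ℝ)) τ) +
        (4 / (δ * D)) * (‖Dp τ‖ ^ 2 * Set.indicator W₀ (fun _ => (1 : ℝ)) τ) +
        (120 / (δ * T)) * (‖Dp τ‖ ^ 2 * (1 + τ ^ 2 / T ^ 2)⁻¹) := by
      funext τ; simp only [hM]; ring
    rw [this]
    exact ((hpieceW.const_mul _).add (hpieceW₀.const_mul _)).add (hpieceB.const_mul _)
  -- `∫ |D|² 𝟙_W = ∫_{max(T/2,F)}^{3T} |D|²`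
  have hmaxle : max (T / 2) F ≤ 3 * T := (max_le (by linarith) hF).trans (by linarith)
  have hA : ∫ τ : ℝ, ‖Dp τ‖ ^ 2 * Set.indicator W (fun _ => (1 : ℝ)) τ =
      ∫ τ in (max (T / 2) F)..(3 * T), ‖Dp τ‖ ^ 2 := by
    rw [show (fun τ : ℝ => ‖Dp τ‖ ^ 2 * Set.indicator W (fun _ => (1 : ℝ)) τ) =
        Set.indicator W (fun τ => ‖Dp τ‖ ^ 2) from funext (hind W), hW,
      integral_indicator measurableSet_Icc, intervalIntegral.integral_of_le hmaxle,
      integral_Icc_eq_integral_Ioc]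
  -- `∫ |D|² 𝟙_{W₀} = ∫_{T/2}^{3T} |D|² ≤ 10 ∫ |D|² (1+τ²/T²)⁻¹ ≤ 10 π Σ (T + 3n)|a_n|²`
  have hA₀ : ∫ τ : ℝ, ‖Dp τ‖ ^ 2 * Set.indicator W₀ (fun _ => (1 : ℝ)) τ ≤
      10 * (π * ∑ n ∈ Finset.Icc 1 N, (T + 3 * n) * ‖a n‖ ^ 2) := by
    have hle : ∀ τ, ‖Dp τ‖ ^ 2 * Set.indicator W₀ (fun _ => (1 : ℝ)) τ ≤
        10 * (‖Dp τ‖ ^ 2 * (1 + τ ^ 2 / T ^ 2)⁻¹) := by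
      intro τ
      by_cases h : τ ∈ W₀
      · rw [Set.indicator_of_mem h, mul_one]
        have hτ3 : τ ≤ 3 * T := h.2
        have hτ0 : 0 ≤ τ := le_trans (by linarith) h.1
        have hk : (1 : ℝ) ≤ 10 * (1 + τ ^ 2 / T ^ 2)⁻¹ := by
          rw [← div_eq_mul_inv, le_div_iff₀ (by positivity)]
          have : τ ^ 2 / T ^ 2 ≤ 9 := by
            rw [div_le_iff₀ (by positivity)]; nlinarith
          linarith
        have h0 : 0 ≤ ‖Dp τ‖ ^ 2 := by positivity
        calc ‖Dp τ‖ ^ 2 = ‖Dp τ‖ ^ 2 * 1 := (mul_one _).symm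
          _ ≤ ‖Dp τ‖ ^ 2 * (10 * (1 + τ ^ 2 / T ^ 2)⁻¹) := mul_le_mul_of_nonneg_left hk h0
          _ = 10 * (‖Dp τ‖ ^ 2 * (1 + τ ^ 2 / T ^ 2)⁻¹) := by ring
      · rw [Set.indicator_of_notMem h, mul_zero]; positivity
    calc ∫ τ : ℝ, ‖Dp τ‖ ^ 2 * Set.indicator W₀ (fun _ => (1 : ℝ)) τ
        ≤ ∫ τ : ℝ, 10 * (‖Dp τ‖ ^ 2 * (1 + τ ^ 2 / T ^ 2)⁻¹) :=
          integral_mono hpieceW₀ (hpieceB.const_mul _) hle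
      _ = 10 * ∫ τ : ℝ, ‖Dp τ‖ ^ 2 * (1 + τ ^ 2 / T ^ 2)⁻¹ := integral_const_mul _ _
      _ ≤ 10 * (π * ∑ n ∈ Finset.Icc 1 N, (T + 3 * n) * ‖a n‖ ^ 2) :=
          mul_le_mul_of_nonneg_left (integral_norm_sq_dpoly_cauchy_le a N hT) (by norm_num)
  have hI : ∫ τ : ℝ, ‖Dp τ‖ ^ 2 * ∑ t ∈ 𝒯, (1 + (τ - t) ^ 2)⁻¹ ≤
      (2 * π / δ) * (∫ τ in (max (T / 2) F)..(3 * T), ‖Dp τ‖ ^ 2) +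
        (4 / (δ * D)) * (10 * (π * ∑ n ∈ Finset.Icc 1 N, (T + 3 * n) * ‖a n‖ ^ 2)) +
        (120 / (δ * T)) * (π * ∑ n ∈ Finset.Icc 1 N, (T + 3 * n) * ‖a n‖ ^ 2) := by
    calc ∫ τ : ℝ, ‖Dp τ‖ ^ 2 * ∑ t ∈ 𝒯, (1 + (τ - t) ^ 2)⁻¹
        ≤ ∫ τ : ℝ, ‖Dp τ‖ ^ 2 * M τ := by
          refine integral_mono hint1 hintM fun τ => ?_
          exact mul_le_mul_of_nonneg_left (hG τ) (by positivity)
      _ = (2 * π / δ) * (∫ τ : ℝ, ‖Dp τ‖ ^ 2 * Set.indicator W (fun _ => (1 : ℝ)) τ) +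
          (4 / (δ * D)) * (∫ τ : ℝ, ‖Dp τ‖ ^ 2 * Set.indicator W₀ (fun _ => (1 : ℝ)) τ) +
          (120 / (δ * T)) * ∫ τ : ℝ, ‖Dp τ‖ ^ 2 * (1 + τ ^ 2 / T ^ 2)⁻¹ := by
          have h12 : Integrable fun τ : ℝ =>
              (2 * π / δ) * (‖Dp τ‖ ^ 2 * Set.indicator W (fun _ => (1 : ℝ)) τ) +
              (4 / (δ * D)) * (‖Dp τ‖ ^ 2 * Set.indicator W₀ (fun _ => (1 : ℝ)) τ) :=
            (hpieceW.const_mul _).add (hpieceW₀.const_mul _)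
          have e1 : (fun τ : ℝ => ‖Dp τ‖ ^ 2 * M τ) = fun τ =>
              ((2 * π / δ) * (‖Dp τ‖ ^ 2 * Set.indicator W (fun _ => (1 : ℝ)) τ) +
              (4 / (δ * D)) * (‖Dp τ‖ ^ 2 * Set.indicator W₀ (fun _ => (1 : ℝ)) τ)) +
              (120 / (δ * T)) * (‖Dp τ‖ ^ 2 * (1 + τ ^ 2 / T ^ 2)⁻¹) := by
            funext τ; simp only [hM]; ring
          rw [e1, integral_add h12 (hpieceB.const_mul _),
            integral_add (hpieceW.const_mul _) (hpieceW₀.const_mul _),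
            integral_const_mul, integral_const_mul, integral_const_mul]
      _ ≤ _ := by
          rw [hA]
          gcongr
          exact integral_norm_sq_dpoly_cauchy_le a N hT
  -- the trivial terms: `(40π/(δD) + 120π/(δT)) Σ (T+3n)|a_n|² ≤ (360π/δ)(T/D + 1) Σ(1 + n/T)|a_n|²`
  set E₀ : ℝ := ∑ n ∈ Finset.Icc 1 N, (1 + n / T) * ‖a n‖ ^ 2 with hE₀
  have hE₀0 : 0 ≤ E₀ := Finset.sum_nonneg fun n _ => by positivity
  have hS3 : ∑ n ∈ Finset.Icc 1 N, (T + 3 * n) * ‖a n‖ ^ 2 ≤ 3 * T * E₀ := by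
    rw [hE₀, Finset.mul_sum]
    refine Finset.sum_le_sum fun n _ => ?_
    have hn0 : (0 : ℝ) ≤ n := Nat.cast_nonneg n
    have hx : 0 ≤ ‖a n‖ ^ 2 := sq_nonneg _
    have e : 3 * T * ((1 + n / T) * ‖a n‖ ^ 2) = (3 * T + 3 * n) * ‖a n‖ ^ 2 := by
      field_simp
    rw [e]
    exact mul_le_mul_of_nonneg_right (by linarith) hx
  have hS : (4 / (δ * D)) * (10 * (π * ∑ n ∈ Finset.Icc 1 N, (T + 3 * n) * ‖a n‖ ^ 2)) +
      (120 / (δ * T)) * (π * ∑ n ∈ Finset.Icc 1 N, (T + 3 * n) * ‖a n‖ ^ 2) ≤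
      (360 * π / δ) * ((T / D + 1) * E₀) := by
    have hsum0 : 0 ≤ ∑ n ∈ Finset.Icc 1 N, (T + 3 * n) * ‖a n‖ ^ 2 :=
      Finset.sum_nonneg fun n _ => by positivity
    calc (4 / (δ * D)) * (10 * (π * ∑ n ∈ Finset.Icc 1 N, (T + 3 * n) * ‖a n‖ ^ 2)) +
          (120 / (δ * T)) * (π * ∑ n ∈ Finset.Icc 1 N, (T + 3 * n) * ‖a n‖ ^ 2)
        = (40 * π / (δ * D) + 120 * π / (δ * T)) * ∑ n ∈ Finset.Icc 1 N, (T + 3 * n) * ‖a n‖ ^ 2 := by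
          ring
      _ ≤ (40 * π / (δ * D) + 120 * π / (δ * T)) * (3 * T * E₀) :=
          mul_le_mul_of_nonneg_left hS3 (by positivity)
      _ = (360 * π / δ) * ((T / D / 3 + 1) * E₀) := by
          field_simp
          ring
      _ ≤ (360 * π / δ) * ((T / D + 1) * E₀) := by
          have h1 : T / D / 3 ≤ T / D := by
            rw [div_le_iff₀ (by norm_num : (0:ℝ) < 3)]
            have : 0 ≤ T / D := by positivity
            linarith
          gcongr
  have hI0' : 0 ≤ ∫ τ in (max (T / 2) F)..(3 * T), ‖Dp τ‖ ^ 2 :=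
    intervalIntegral.integral_nonneg hmaxle fun τ _ => by positivity
  have hTD0 : 0 ≤ (T / D + 1) * E₀ := by positivity
  calc c / (2 * π) * ∫ τ : ℝ, ‖Dp τ‖ ^ 2 * ∑ t ∈ 𝒯, (1 + (τ - t) ^ 2)⁻¹
      ≤ c / (2 * π) * ((2 * π / δ) * (∫ τ in (max (T / 2) F)..(3 * T), ‖Dp τ‖ ^ 2) +
          (360 * π / δ) * ((T / D + 1) * E₀)) := by
        refine mul_le_mul_of_nonneg_left (hI.trans ?_) (by positivity)
        linarith [hS]
    _ = c * δ⁻¹ * ((∫ τ in (max (T / 2) F)..(3 * T), ‖Dp τ‖ ^ 2) +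
          180 * ((T / D + 1) * E₀)) := by
        field_simp
        ring
    _ ≤ 180 * c * δ⁻¹ * ((∫ τ in (max (T / 2) F)..(3 * T), ‖Dp τ‖ ^ 2) + (T / D + 1) * E₀) := by
        have hcδ : 0 ≤ c * δ⁻¹ := by positivity
        nlinarith [mul_nonneg hcδ hI0', mul_nonneg hcδ hTD0]

/-! ## §4. The series form -/

/-- **Proposition 5.4 one-sided at a floor, for absolutely convergent Dirichlet series.**
Let `a : ℕ → ℂ` with `a₀ = 0`, `Σ ‖a_n‖ < ∞` and `Σ (1 + n/T)‖a_n‖² < ∞`; let `𝒯 ⊂ [T, 2T]`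
(`T ≥ 2`) be `δ`-separated (`0 < δ ≤ 1`) with every point `≥ F + D` (`D ≥ 1`, `F ≤ T`), and for
`t ∈ 𝒯` let `ω_t ∈ C¹(ℝ)` with `ω_t, ω_t′ ∈ L¹ ∩ L²`, `‖ω_t‖₂² + ‖ω_t′‖₂² ≤ c` and `‖ω_t‖_∞ ≤ B`. Then
`Σ_t |Σ_n a_n ω_t(log n) n^{−it}|² ≤ 180·c·δ⁻¹·(∫_{max(T/2,F)}^{3T} |Σ_n a_n n^{−iτ}|² dτ + (T/D+1)Σ_n (1+n/T)|a_n|²)`.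
[cite: ConreyIwaniec2002, Proposition 5.4 (5.19)] -/
theorem weighted_discreteMeanValue_integral_floor_tsum (a : ℕ → ℂ) {T δ c B F D : ℝ} (𝒯 : Finset ℝ)
    (ω : ℝ → ℝ → ℂ) (hT : 2 ≤ T) (hδ : 0 < δ) (hδ1 : δ ≤ 1) (hc : 0 ≤ c) (hD : 1 ≤ D) (hF : F ≤ T)
    (ha0 : a 0 = 0) (ha1 : Summable fun n => ‖a n‖)
    (ha2 : Summable fun n => (1 + n / T) * ‖a n‖ ^ 2)
    (hmem : ∀ t ∈ 𝒯, T ≤ t ∧ t ≤ 2 * T) (hfl : ∀ t ∈ 𝒯, F + D ≤ t)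
    (hsep : ∀ t ∈ 𝒯, ∀ t' ∈ 𝒯, t ≠ t' → δ ≤ |t - t'|)
    (hω : ∀ t ∈ 𝒯, Differentiable ℝ (ω t) ∧ Integrable (ω t) ∧ Integrable (deriv (ω t)) ∧
      MemLp (ω t) 2 ∧ MemLp (deriv (ω t)) 2 ∧
      (∫ y : ℝ, ‖ω t y‖ ^ 2) + (∫ y : ℝ, ‖deriv (ω t) y‖ ^ 2) ≤ c)
    (hωB : ∀ t ∈ 𝒯, ∀ y, ‖ω t y‖ ≤ B) :
    ∑ t ∈ 𝒯, ‖∑' n : ℕ, a n * ω t (Real.log n) * (n : ℂ) ^ (-((t : ℂ) * I))‖ ^ 2 ≤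
      180 * c * δ⁻¹ *
        ((∫ τ in (max (T / 2) F)..(3 * T), ‖∑' n : ℕ, a n * (n : ℂ) ^ (-((τ : ℂ) * I))‖ ^ 2) +
          (T / D + 1) * ∑' n : ℕ, (1 + n / T) * ‖a n‖ ^ 2) := by
  have hT0 : 0 < T := by linarith
  -- notation
  set A : ℝ := ∑' n : ℕ, ‖a n‖ with hA
  have hA0 : 0 ≤ A := tsum_nonneg fun n => norm_nonneg _
  set f : ℝ → ℕ → ℂ := fun t n => a n * ω t (Real.log n) * (n : ℂ) ^ (-((t : ℂ) * I)) with hf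
  set g : ℝ → ℕ → ℂ := fun τ n => a n * (n : ℂ) ^ (-((τ : ℂ) * I)) with hg
  set e : ℕ → ℝ := fun n => (1 + n / T) * ‖a n‖ ^ 2 with he
  -- summability of the pointwise series
  have hB' : ∀ t ∈ 𝒯, 0 ≤ B := fun t ht => (norm_nonneg _).trans (hωB t ht 0)
  have hf_norm : ∀ t ∈ 𝒯, ∀ n, ‖f t n‖ ≤ B * ‖a n‖ := by
    intro t ht n
    simp only [hf, norm_mul]
    calc ‖a n‖ * ‖ω t (Real.log n)‖ * ‖(n : ℂ) ^ (-((t : ℂ) * I))‖ ≤ ‖a n‖ * B * 1 := by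
          gcongr
          · exact mul_nonneg (norm_nonneg _) (hB' t ht)
          · exact hωB t ht _
          · exact norm_natCast_cpow_neg_mul_I_le n t
      _ = B * ‖a n‖ := by ring
  have hf_sum : ∀ t ∈ 𝒯, Summable (f t) := fun t ht =>
    Summable.of_norm_bounded (ha1.mul_left B) (hf_norm t ht)
  have hg_norm : ∀ τ n, ‖g τ n‖ ≤ ‖a n‖ := by
    intro τ n
    simp only [hg, norm_mul]
    calc ‖a n‖ * ‖(n : ℂ) ^ (-((τ : ℂ) * I))‖ ≤ ‖a n‖ * 1 :=
          mul_le_mul_of_nonneg_left (norm_natCast_cpow_neg_mul_I_le n τ) (norm_nonneg _)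
      _ = ‖a n‖ := mul_one _
  have hg_sum : ∀ τ, Summable (g τ) := fun τ => Summable.of_norm_bounded ha1 (hg_norm τ)
  have hf0 : ∀ t, f t 0 = 0 := fun t => by simp [hf, ha0]
  have hg0 : ∀ τ, g τ 0 = 0 := fun τ => by simp [hg, ha0]
  have he0 : e 0 = 0 := by simp [he, ha0]
  -- the finite statement for the partial sums over `range M` (= `Icc 1 (M-1)`)
  have hfin : ∀ M : ℕ,
      ∑ t ∈ 𝒯, ‖∑ n ∈ Finset.range M, f t n‖ ^ 2 ≤
        180 * c * δ⁻¹ * ((∫ τ in (max (T / 2) F)..(3 * T), ‖∑ n ∈ Finset.range M, g τ n‖ ^ 2) +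
          (T / D + 1) * ∑ n ∈ Finset.range M, e n) := by
    intro M
    have h := weighted_discreteMeanValue_integral_floor (M - 1) a 𝒯 ω hT hδ hδ1 hc hD hF hmem hfl hsep hω
    have e1 : ∀ t, ∑ n ∈ Finset.range M, f t n = ∑ n ∈ Finset.Icc 1 (M - 1), f t n :=
      fun t => sum_range_eq_sum_Icc_of_zero (hf0 t) M
    have e2 : ∀ τ, ∑ n ∈ Finset.range M, g τ n = ∑ n ∈ Finset.Icc 1 (M - 1), g τ n :=
      fun τ => sum_range_eq_sum_Icc_of_zero (hg0 τ) M
    have e3 : ∑ n ∈ Finset.range M, e n = ∑ n ∈ Finset.Icc 1 (M - 1), e n :=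
      sum_range_eq_sum_Icc_of_zero_real he0 M
    simp_rw [e1, e2, e3]
    exact h
  -- limits as `M → ∞`: the left side
  have hL : Tendsto (fun M => ∑ t ∈ 𝒯, ‖∑ n ∈ Finset.range M, f t n‖ ^ 2) atTop
      (𝓝 (∑ t ∈ 𝒯, ‖∑' n, f t n‖ ^ 2)) := by
    refine tendsto_finsetSum 𝒯 fun t ht => ?_
    exact (((hf_sum t ht).tendsto_sum_tsum_nat).norm).pow 2
  -- the error sum
  have hE : Tendsto (fun M => ∑ n ∈ Finset.range M, e n) atTop (𝓝 (∑' n, e n)) :=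
    ha2.tendsto_sum_tsum_nat
  -- the integral, by dominated convergence with the constant majorant `A²`
  have hmaxle : max (T / 2) F ≤ 3 * T := (max_le (by linarith) hF).trans (by linarith)
  have hgc : ∀ n, Continuous fun τ : ℝ => g τ n := by
    intro n
    rcases Nat.eq_zero_or_pos n with rfl | hn
    · simp only [hg0]; exact continuous_const
    · have : (fun τ : ℝ => g τ n) = fun τ => a n * phase n τ := by
        funext τ; simp only [hg]; rw [natCast_cpow_eq_phase (by omega)]
      rw [this]; exact continuous_const.mul (continuous_phase n)
  have hI : Tendsto (fun M => ∫ τ in (max (T / 2) F)..(3 * T), ‖∑ n ∈ Finset.range M, g τ n‖ ^ 2) atTop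
      (𝓝 (∫ τ in (max (T / 2) F)..(3 * T), ‖∑' n, g τ n‖ ^ 2)) := by
    refine intervalIntegral.tendsto_integral_filter_of_dominated_convergence (fun _ => A ^ 2) ?_ ?_ ?_ ?_
    · exact Eventually.of_forall fun M =>
        ((continuous_finsetSum _ fun n _ => hgc n).norm.pow 2).aestronglyMeasurable
    · refine Eventually.of_forall fun M => Eventually.of_forall fun τ _ => ?_
      rw [Real.norm_of_nonneg (by positivity)]
      have hle : ‖∑ n ∈ Finset.range M, g τ n‖ ≤ A := by
        calc ‖∑ n ∈ Finset.range M, g τ n‖ ≤ ∑ n ∈ Finset.range M, ‖g τ n‖ := norm_sum_le _ _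
          _ ≤ ∑ n ∈ Finset.range M, ‖a n‖ := Finset.sum_le_sum fun n _ => hg_norm τ n
          _ ≤ A := ha1.sum_le_tsum _ (fun n _ => norm_nonneg _)
      exact pow_le_pow_left₀ (norm_nonneg _) hle 2
    · exact intervalIntegrable_const
    · refine Eventually.of_forall fun τ _ => ?_
      exact (((hg_sum τ).tendsto_sum_tsum_nat).norm).pow 2
  have hR : Tendsto (fun M => 180 * c * δ⁻¹ *
      ((∫ τ in (max (T / 2) F)..(3 * T), ‖∑ n ∈ Finset.range M, g τ n‖ ^ 2) +
        (T / D + 1) * ∑ n ∈ Finset.range M, e n))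
      atTop (𝓝 (180 * c * δ⁻¹ * ((∫ τ in (max (T / 2) F)..(3 * T), ‖∑' n, g τ n‖ ^ 2) +
        (T / D + 1) * ∑' n, e n))) :=
    (hI.add (hE.const_mul _)).const_mul _
  exact le_of_tendsto_of_tendsto' hL hR hfin

end WeightedMeanValue

end Literature.NumberTheory.LFunctions

end
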